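import Summits.AtomisticToContinuum.Crystallization.Theorems.FrustratedLawDichotomyStrainedPatchHomEntryLeafHTMustPassA

/-!
# MUST-PASS CELL of the analytic-slab leaf at `0.8 t_b`, part B: the matrix-shifted curvature certificate and the chunked slope certificate

decomp-a2c hand-1 g29 (crux `AperiodicFrustratedLawGap`, stmt-AtomisticToContinuum-27623).  See `…MustPassA` for the cell `cA × wA` and the certificate `pA`.
Kernel facts (each `< 2 min`): `curvCheckLJM_A` (`DA`-shifted centred LJ force-Jacobian certificate on the near labels at floor `0.75·SC`), `slope_near_A`,
`slope_far1_A`, `slope_far2_A` (naive guards + `htGs ≤ 566.5·10⁹ / 8.7·10⁹ / 3·10⁹`; sum `≤ pA.Gs = 578.5·10⁹`).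

Kernel facts only; 0 sorry; standard axioms.  `--supports stmt-AtomisticToContinuum-27623`.
-/

namespace Summit.AtomisticToContinuum.Crystallization.Theorems.FrustratedLawDichotomyStrainedPatchHomEntryLeafHT

open Literature.Analysis.ValidatedNumerics.Numerics
open Summit.AtomisticToContinuum.Crystallization.Theorems.FrustratedLawDichotomyStrainedPatchHomCurvLJ (curvCheckLJM)
open Summit.AtomisticToContinuum.Crystallization.Theorems.FrustratedLawDichotomyStrainedPatchHomForceJacN (forceJacCheckN)
open Summit.AtomisticToContinuum.Crystallization.Theorems.FrustratedLawDichotomyStrainedPatchHomForceHcp (xiBallOK)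
open Summit.AtomisticToContinuum.Crystallization.Theorems.FrustratedLawDichotomyStrainedPatchHomCertTree (CertTree treeOK)
open Summit.AtomisticToContinuum.Crystallization.Theorems.FrustratedLawDichotomyStrainedPatchHomEntryQuickHcp (entryLeafOKHQ)
open Summit.AtomisticToContinuum.Crystallization.Theorems.FrustratedLawDichotomyStrainedPatchHomEntryTable (muRec)

/-- ★ KERNEL: the `DA`-shifted centred LJ force-Jacobian certificate on the near labels of the cell certifies the floor `0.75·SC`. -/
theorem curvCheckLJM_A : curvCheckLJM cA wA (htCen cA wA) (htNai cA wA) DA 211106232532992 = true := by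
  decide +kernel

/-- ★ KERNEL: chunked slope, near chunk (350 labels): `htGs ≤ 566.5·10⁹` (`0.00201·SC`). -/
theorem slope_near_A : (htNaiOK cA wA (htNear cA wA) && decide (htGs cA wA (htNear cA wA) ≤ 566500000000)) = true := by
  decide +kernel

/-- ★ KERNEL: chunked slope, far chunk 1: `htGs ≤ 8.7·10⁹`. -/
theorem slope_far1_A : (htNaiOK cA wA (htFar1 cA wA) && decide (htGs cA wA (htFar1 cA wA) ≤ 8700000000)) = true := by
  decide +kernel

/-- ★ KERNEL: chunked slope, far chunk 2: `htGs ≤ 3·10⁹`. -/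
theorem slope_far2_A : (htNaiOK cA wA (htFar2 cA wA) && decide (htGs cA wA (htFar2 cA wA) ≤ 3000000000)) = true := by
  decide +kernel

end Summit.AtomisticToContinuum.Crystallization.Theorems.FrustratedLawDichotomyStrainedPatchHomEntryLeafHT
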